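import Mathlib.RingTheory.MvPolynomial.Symmetric.NewtonIdentities
import Mathlib.Data.Multiset.Fintype
import Mathlib.Analysis.Calculus.Deriv.Star
import Mathlib.Analysis.Calculus.DSlope
import Literature.NumberTheory.Automorphic.PairLFunctionMeromorphicContinuation
import Literature.NumberTheory.Automorphic.PairLFunctionConjHolomorphy
import Literature.NumberTheory.Automorphic.GLnCentralCharacter
import Literature.NumberTheory.GaloisRepresentations.HeckeLFunctionNonvanishingProofs
import HarnessLib

/-!
# Arthur–Clozel (2.2) at `s = 1` for `n ≠ m` from the Mœglin–Waldspurger continuation, by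
# de la Vallée Poussin's positivity argument and Landau's lemma

Topic `NumberTheory/Automorphic`; namespace `Literature.NumberTheory.Automorphic`. Proof file
(theorems only: no definition, no named fact, no instance) under the named fact
`JacquetShalika1981_partialPairL_at_one_of_rank_ne` of `PairLFunctionPoles` — Arthur–Clozel,
*Simple algebras, base change, and the advanced theory of the trace formula*, Ann. of Math.
Stud. 120 (1989), Ch. 3 §2, (2.2), p. 171 of the held copy, at `s₀ = 1` for cuspidal `π` on
`GL_n`, `σ` on `GL_m`, **`n ≠ m`**: "the function `L^S` extends continuously to the line `Re s = 1`
… Moreover, it does not vanish there" ("cf. [Jacquet–Shalika II, Prop. 3.6]. The non-vanishing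
part of these results is due to Shahidi"). In print the two halves are (A) the continuation
(Jacquet–Piatetski-Shapiro–Shalika / Mœglin–Waldspurger: `L(s, π × σ)` is *entire* for `n ≠ m`)
and (B) Shahidi's non-vanishing `L_S(1 + it, π × σ) ≠ 0` by Eisenstein series on `GL_{n+m}`.

This file proves the fact from the **continuation alone**, i.e. from the tree's named facts
`MoeglinWaldspurger1989_partialPairL_entire_of_rank_ne` (Corollaire (i)(a): `L^S(s, π ⊗ σ)` entire
for `n ≠ m`) and `MoeglinWaldspurger1989_partialPairL_of_eq_conj` (Corollaire (ii):
`s (s - 1) L^S(s, π ⊗ π̃)` entire) of `PairLFunctionMeromorphicContinuation`, replacing Shahidi's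
theorem (B) by **de la Vallée Poussin's positivity argument in its Rankin–Selberg form**
(Gelbart (2007), §2, "The Rankin–Selberg generalization of de la Vallée Poussin": the auxiliary
Dirichlet series `D(s) = L(s, Π × Π̃)` of an isobaric `Π` has non-negative coefficients and the
multiplicativity `L(s, (π ⊞ σ̄) × (π̄ ⊞ σ)) = L(π × π̄) L(π × σ) L(σ̄ × π̄) L(σ̄ × σ)`; Moreno (1985);
Hoffstein–Ramakrishnan (1995), §1) together with **Landau's lemma** (Montgomery–Vaughan Thm. 1.7,
in the tree as `Literature.NumberTheory.LFunctions.Landau.abscissaOfAbsConv_le_of_exp_eq`):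

* *Positivity.* For the Satake family `γ = α ⊞ β̄ : v ↦ α v + conj (β v)` of "`π ⊞ σ̄`" (a multiset
  sum; no automorphic object is needed), `log L^S(s, γ ⊗ γ̄) = ∑_v ∑_k |tr A_v^k + conj tr B_v^k|²
  q_v^{-ks} / k` has non-negative coefficients, and on `Re s > 1`
  `L^S(s, γ ⊗ γ̄) = L^S(α ⊗ ᾱ) · L^S(α ⊗ β) · L^S(β̄ ⊗ ᾱ) · L^S(β̄ ⊗ β)` (`partialPairL_boxplus_eq`:
  `det(1 - (A ⊕ B̄) ⊗ (Ā ⊕ B) T)` factors, and the four Euler products converge by Jacquet–Shalika's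
  (2.1), `JacquetShalika1981_multipliable_partialPairL_holds`).
* *The zero would be double.* If the entire continuation `E` of `L^S(s, π ⊗ σ)` had `E(1) = 0`,
  then so would `E'(s) = conj E(conj s)`, the continuation of `L^S(s, σ̄ ⊗ π̄)`
  (`conj_partialPairL`), and `D = G_π G_σ · (E/(s-1)) · (E'/(s-1)) / s²` — with `G_π`, `G_σ` the
  entire continuations of `s (s - 1) L^S(s, π ⊗ π̄)`, `s (s - 1) L^S(s, σ̄ ⊗ σ)` — would be
  holomorphic on `Re s > 0` and equal to `L^S(s, γ ⊗ γ̄) = exp(∑ a_m m^{-s})` on `Re s > 2`; by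
  Landau's lemma the series `∑_v ∑_k |p_k(γ_v)|² q_v^{-kσ}/k` would converge for every `σ > 0`.
* *Divergence at `σ = 1/(n+m)`.* But `|∏ γ_v| = |ω_π(ϖ_v)| |ω_σ(ϖ_v)| = 1` (unitary central
  characters, `CuspidalAutomorphicRepGL.exists_centralCharacter`), so by **Newton's identities**
  (Mathlib `MvPolynomial.mul_esymm_eq_sum`) `max_{k ≤ n+m} |p_k(γ_v)| ≥ 2^{-(n+m+1)}`
  (`exists_norm_powerSum_ge_of_norm_prod_eq_one`), and the series dominates
  `c ∑_v q_v^{-1} = ∞` (`not_summable_residueCard_inv`). Hence `E(1) ≠ 0`, and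
  `L^S(s, π ⊗ σ) → E(1)` as `s → 1`, `Re s > 1`.

Main results: `partialPairL_continuation_apply_one_ne_zero` (the analytic core, hypotheses = the
three continuations), `JacquetShalika1981_partialPairL_at_one_of_rank_ne_of_moeglinWaldspurger`
(**the named fact (2.2), `n ≠ m`, `s₀ = 1`, from the two Mœglin–Waldspurger facts and nothing
else**) and, by the same argument in equal rank,
`JacquetShalika1981_partialPairL_at_one_of_ne_conj_of_moeglinWaldspurger` ((2.2) at `s₀ = 1` for
`π ≇ σ̃` from Corollaire (i)(b) and (ii)).

## References

* J. Arthur, L. Clozel, *Simple algebras, base change, and the advanced theory of the trace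
  formula*, Ann. of Math. Stud. 120 (1989), Ch. 3 §2, (2.2), p. 171. [ArthurClozelAMS120]
* C. Mœglin, J.-L. Waldspurger, *Le spectre résiduel de `GL(n)`*, Ann. Sci. ÉNS (4) 22 (1989),
  Appendice, Corollaire, p. 667. [MoeglinWaldspurger1989]
* S. Gelbart, *When is an `L`-function non-vanishing in part of the critical strip?*, in:
  Harmonic Analysis, Group Representations, Automorphic Forms and Invariant Theory (in honor of
  R. Howe), Lect. Notes Ser. Inst. Math. Sci. Natl. Univ. Singap. 12, World Scientific (2007),
  §2 (pp. 70–72 of the held volume). [Gelbart2007Nonvanishing]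
* H. L. Montgomery, R. C. Vaughan, *Multiplicative Number Theory I*, CUP (2007), §1.2, Thm. 1.7
  (Landau). [MontgomeryVaughan2007]
* H. Jacquet, J. A. Shalika, *On Euler products and the classification of automorphic
  representations I*, Amer. J. Math. 103 (1981), Thm. (5.3) and its proof. [JacquetShalikaAJM1981]
-/

noncomputable section

open scoped Topology ComplexConjugate
open NumberField IsDedekindDomain MeasureTheory Filter Complex

namespace Literature.NumberTheory.Automorphic

/-! ### Newton's identities: a lower bound for power sums of numbers with product of modulus one -/

section Newton

open Finset

variable {ι : Type*} [Fintype ι]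

/-- **Newton's identity, evaluated** (Mathlib `MvPolynomial.mul_esymm_eq_sum` under `aeval f`):
`k e_k = (-1)^{k+1} ∑_{i+j=k, i<k} (-1)^i e_i p_j` for the elementary symmetric functions `e_i`
and the power sums `p_j = ∑ f^j` of a finite family of complex numbers. [folklore] -/
theorem natCast_mul_esymm_eq_sum_powerSum (f : ι → ℂ) (k : ℕ) :
    (k : ℂ) * (univ.val.map f).esymm k = (-1) ^ (k + 1) *
      ∑ a ∈ antidiagonal k with a.1 < k,
        (-1) ^ a.1 * (univ.val.map f).esymm a.1 * ∑ i, f i ^ a.2 := by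
  have h := congrArg (MvPolynomial.aeval f) (MvPolynomial.mul_esymm_eq_sum ι ℂ k)
  simpa only [map_mul, map_natCast, map_pow, map_neg, map_one, map_sum,
    MvPolynomial.aeval_esymm_eq_multiset_esymm, MvPolynomial.psum, MvPolynomial.aeval_X] using h

/-- `e_0 = 1`. [folklore] -/
theorem esymm_map_zero (f : ι → ℂ) : (univ.val.map f).esymm 0 = 1 := by
  simp [Multiset.esymm, Multiset.powersetCard_zero_left]

/-- `e_N = ∏ f` for `N` the number of variables. [folklore] -/
theorem esymm_map_card_eq_prod (f : ι → ℂ) :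
    (univ.val.map f).esymm (Fintype.card ι) = ∏ i, f i := by
  rw [Finset.esymm_map_val, ← Finset.card_univ, Finset.powersetCard_self, Finset.sum_singleton]

/-- `∑_{i<k} 2^i ≤ 2^k`. [folklore] -/
theorem sum_range_two_pow_le (k : ℕ) : ∑ i ∈ range k, (2 : ℝ) ^ i ≤ 2 ^ k := by
  induction k with
  | zero => simp
  | succ k ih => rw [sum_range_succ, pow_succ]; linarith

/-- **Crude Newton bound.** If `|p_j| ≤ δ ≤ 1` for `1 ≤ j ≤ k` then `|e_k| ≤ 2^k δ` (`k ≥ 1`):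
by strong induction, `k |e_k| ≤ ∑_{i<k} |e_i| |p_{k-i}| ≤ ∑_{i<k} 2^i δ ≤ 2^k δ`. [folklore] -/
theorem norm_esymm_le_two_pow_mul (f : ι → ℂ) {δ : ℝ} (hδ0 : 0 ≤ δ) (hδ1 : δ ≤ 1) :
    ∀ k : ℕ, 1 ≤ k → (∀ j, 1 ≤ j → j ≤ k → ‖∑ i, f i ^ j‖ ≤ δ) →
      ‖(univ.val.map f).esymm k‖ ≤ 2 ^ k * δ := by
  intro k
  induction k using Nat.strong_induction_on with
  | _ k ih =>
    intro hk hp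
    -- the filtered antidiagonal is the antidiagonal with `(k, 0)` removed
    have hfilt : (antidiagonal k).filter (fun a : ℕ × ℕ => a.1 < k) = (antidiagonal k).erase (k, 0) := by
      ext ⟨i, j⟩
      simp only [mem_filter, mem_erase, Finset.HasAntidiagonal.mem_antidiagonal, ne_eq,
        Prod.mk.injEq]
      constructor
      · rintro ⟨h, hi⟩
        exact ⟨fun h' => absurd h'.1 hi.ne, h⟩
      · rintro ⟨hne, h⟩
        refine ⟨h, lt_of_le_of_ne (by omega) fun hi => hne ⟨hi, by omega⟩⟩
    have hmem : (k, 0) ∈ antidiagonal k := by simp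
    -- termwise bound on the erased antidiagonal
    have hterm : ∀ a ∈ (antidiagonal k).erase (k, 0),
        ‖(-1 : ℂ) ^ a.1 * (univ.val.map f).esymm a.1 * ∑ i, f i ^ a.2‖ ≤ 2 ^ a.1 * δ := by
      intro a ha
      rw [mem_erase, Finset.HasAntidiagonal.mem_antidiagonal] at ha
      obtain ⟨hne, hsum⟩ := ha
      have ha1 : a.1 < k := by
        rcases Nat.lt_or_ge a.1 k with h | h
        · exact h
        · exfalso
          have h1 : a.1 = k := by omega
          have h2 : a.2 = 0 := by omega
          exact hne (Prod.ext h1 h2)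
      have ha2 : 1 ≤ a.2 := by omega
      have ha2' : a.2 ≤ k := by omega
      rw [norm_mul, norm_mul, norm_pow, norm_neg, norm_one, one_pow, one_mul]
      have he : ‖(univ.val.map f).esymm a.1‖ ≤ 2 ^ a.1 := by
        rcases Nat.eq_zero_or_pos a.1 with h0 | h0
        · rw [h0, esymm_map_zero, norm_one, pow_zero]
        · calc ‖(univ.val.map f).esymm a.1‖ ≤ 2 ^ a.1 * δ :=
                ih a.1 ha1 h0 fun j hj1 hj2 => hp j hj1 (hj2.trans ha1.le)
            _ ≤ 2 ^ a.1 * 1 := mul_le_mul_of_nonneg_left hδ1 (by positivity)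
            _ = 2 ^ a.1 := mul_one _
      exact mul_le_mul he (hp a.2 ha2 ha2') (norm_nonneg _) (by positivity)
    -- sum the bounds
    have hk0 : (0 : ℝ) < k := by exact_mod_cast hk
    have hmain : (k : ℝ) * ‖(univ.val.map f).esymm k‖ ≤ 2 ^ k * δ := by
      calc (k : ℝ) * ‖(univ.val.map f).esymm k‖ = ‖(k : ℂ) * (univ.val.map f).esymm k‖ := by
            rw [norm_mul, Complex.norm_natCast]
        _ = ‖∑ a ∈ (antidiagonal k).erase (k, 0),
              (-1 : ℂ) ^ a.1 * (univ.val.map f).esymm a.1 * ∑ i, f i ^ a.2‖ := by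
            rw [natCast_mul_esymm_eq_sum_powerSum, hfilt, norm_mul, norm_pow, norm_neg, norm_one,
              one_pow, one_mul]
        _ ≤ ∑ a ∈ (antidiagonal k).erase (k, 0),
              ‖(-1 : ℂ) ^ a.1 * (univ.val.map f).esymm a.1 * ∑ i, f i ^ a.2‖ := norm_sum_le _ _
        _ ≤ ∑ a ∈ (antidiagonal k).erase (k, 0), (2 : ℝ) ^ a.1 * δ := sum_le_sum hterm
        _ = (∑ a ∈ antidiagonal k, (2 : ℝ) ^ a.1 * δ) - 2 ^ k * δ := by
            rw [sum_erase_eq_sub hmem]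
        _ = ∑ i ∈ range k, (2 : ℝ) ^ i * δ := by
            rw [Nat.sum_antidiagonal_eq_sum_range_succ_mk, sum_range_succ]
            ring
        _ ≤ 2 ^ k * δ := by
            rw [← sum_mul]
            exact mul_le_mul_of_nonneg_right (sum_range_two_pow_le k) hδ0
    have h1 : ‖(univ.val.map f).esymm k‖ ≤ (k : ℝ) * ‖(univ.val.map f).esymm k‖ :=
      le_mul_of_one_le_left (norm_nonneg _) (by exact_mod_cast hk)
    exact h1.trans hmain

/-- **Power sums of numbers with `|∏| = 1` cannot all be small**: if `|∏ᵢ fᵢ| = 1` (`N ≥ 1`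
variables) then `|∑ᵢ fᵢ^j| ≥ 2^{-(N+1)}` for some `1 ≤ j ≤ N` — otherwise the crude Newton bound
gives `1 = |e_N| ≤ 2^N · 2^{-(N+1)} = 1/2`. [folklore] -/
theorem exists_norm_powerSum_ge_fintype (f : ι → ℂ) (hN : 1 ≤ Fintype.card ι)
    (hprod : ‖∏ i, f i‖ = 1) :
    ∃ j, 1 ≤ j ∧ j ≤ Fintype.card ι ∧ 1 / 2 ^ (Fintype.card ι + 1) ≤ ‖∑ i, f i ^ j‖ := by
  by_contra! h
  have hδ1 : (1 : ℝ) / 2 ^ (Fintype.card ι + 1) ≤ 1 := by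
    rw [div_le_one (by positivity)]
    exact one_le_pow₀ (by norm_num)
  have hb := norm_esymm_le_two_pow_mul f (by positivity) hδ1 (Fintype.card ι) hN
    fun j hj1 hj2 => (h j hj1 hj2).le
  rw [esymm_map_card_eq_prod, hprod] at hb
  have h2 : (2 : ℝ) ^ Fintype.card ι * (1 / 2 ^ (Fintype.card ι + 1)) = 1 / 2 := by
    rw [pow_succ]
    field_simp
  rw [h2] at hb
  linarith

/-- **Multiset form**: for a multiset `γ` of `N ≥ 1` complex numbers with `|∏ γ| = 1` there is
`1 ≤ j ≤ N` with `|p_j(γ)| = |∑_{c ∈ γ} c^j| ≥ 2^{-(N+1)}`. [folklore] -/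
theorem exists_norm_powerSum_ge_of_norm_prod_eq_one (γ : Multiset ℂ) (hN : 1 ≤ Multiset.card γ)
    (hprod : ‖γ.prod‖ = 1) :
    ∃ j, 1 ≤ j ∧ j ≤ Multiset.card γ ∧
      1 / 2 ^ (Multiset.card γ + 1) ≤ ‖(γ.map (· ^ j)).sum‖ := by
  have hc : Fintype.card γ = Multiset.card γ := Multiset.card_coe γ
  have hprod' : ‖∏ x : γ, (x : ℂ)‖ = 1 := by
    rw [← Multiset.prod_eq_prod_coe]
    exact hprod
  obtain ⟨j, hj1, hj2, hj⟩ := exists_norm_powerSum_ge_fintype (fun x : γ => (x : ℂ)) (hc ▸ hN) hprod'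
  refine ⟨j, hj1, hc ▸ hj2, ?_⟩
  have hsum : ∑ x : γ, (x : ℂ) ^ j = (γ.map (· ^ j)).sum := by
    rw [Finset.sum_eq_multiset_sum, Multiset.map_univ γ (· ^ j)]
  rw [hc, hsum] at hj
  exact hj

end Newton

/-! ### Divergence: `∑_v ∑_{k ≤ N} |p_k(γ_v)|² q_v^{-k/N} / k = ∞` when `|∏ γ_v| = 1` -/

section Divergence

variable {K : Type} [Field K] [NumberField K]

/-- **The series (5.3.3) of `γ` diverges at `σ = 1/N`** when every `γ_v` (`v ∉ S`, `S` finite) has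
`N ≥ 1` entries with `|∏ γ_v| = 1`: each place contributes at least
`|p_{j_v}(γ_v)|² q_v^{-j_v/N} / j_v ≥ 4^{-(N+1)} N⁻¹ q_v^{-1}` for the `j_v ≤ N` of
`exists_norm_powerSum_ge_of_norm_prod_eq_one`, and `∑_v q_v^{-1} = ∞`
(`not_summable_residueCard_inv`). [folklore] -/
theorem not_summable_jsCoeff_mul_rpow_neg_of_norm_prod_eq_one {S : Set (HeightOneSpectrum (𝓞 K))}
    (hS : S.Finite) {γ : SatakeFamily K} {N : ℕ} (hN : 1 ≤ N)
    (hcard : ∀ v ∉ S, Multiset.card (γ v) = N) (hprod : ∀ v ∉ S, ‖(γ v).prod‖ = 1) :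
    ¬ Summable fun i : ℕ × {v : HeightOneSpectrum (𝓞 K) // v ∉ S} =>
      jsCoeff S γ i * (jsBase S i : ℝ) ^ (-(1 / N : ℝ)) := by
  intro hsum
  have hj : ∀ v : {v : HeightOneSpectrum (𝓞 K) // v ∉ S}, ∃ j, 1 ≤ j ∧ j ≤ N ∧
      1 / 2 ^ (N + 1) ≤ ‖((γ v.1).map (· ^ j)).sum‖ := fun v => by
    have h := exists_norm_powerSum_ge_of_norm_prod_eq_one (γ v.1)
      ((hcard v.1 v.2).symm ▸ hN) (hprod v.1 v.2)
    rwa [hcard v.1 v.2] at h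
  choose j hj1 hjN hjb using hj
  set g : {v : HeightOneSpectrum (𝓞 K) // v ∉ S} → ℕ × {v : HeightOneSpectrum (𝓞 K) // v ∉ S} :=
    fun v => (j v - 1, v) with hg
  have hginj : Function.Injective g := fun v w h => (Prod.ext_iff.mp h).2
  have h1 := hsum.comp_injective hginj
  set c : ℝ := (1 / 2 ^ (N + 1)) ^ 2 / N with hc
  have hN0 : (0 : ℝ) < N := by exact_mod_cast hN
  have hc0 : 0 < c := by positivity
  have hle : ∀ v : {v : HeightOneSpectrum (𝓞 K) // v ∉ S},
      c * ((v.1.residueCard : ℝ))⁻¹ ≤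
        (fun i : ℕ × {v : HeightOneSpectrum (𝓞 K) // v ∉ S} =>
          jsCoeff S γ i * (jsBase S i : ℝ) ^ (-(1 / N : ℝ))) (g v) := by
    intro v
    have hq1 : (1 : ℝ) ≤ v.1.residueCard := by exact_mod_cast v.1.one_lt_residueCard.le
    have hq0 : (0 : ℝ) < v.1.residueCard := by linarith
    have hjv : ((j v - 1 : ℕ) : ℝ) + 1 = j v := by
      have := hj1 v
      rw [Nat.cast_sub this]
      push_cast
      ring
    show c * ((v.1.residueCard : ℝ))⁻¹ ≤ jsCoeff S γ (j v - 1, v) * (jsBase S (j v - 1, v) : ℝ) ^ (-(1 / N : ℝ))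
    rw [jsCoeff_mul_rpow_neg, hjv, Nat.sub_add_cancel (hj1 v)]
    -- `c q⁻¹ = 4^{-(N+1)} / (N q) ≤ |p_j|² / (j q^{j/N})`
    have hden : (j v : ℝ) * (v.1.residueCard : ℝ) ^ ((j v : ℝ) * (1 / N)) ≤ N * v.1.residueCard := by
      refine mul_le_mul (by exact_mod_cast hjN v) ?_ (by positivity) hN0.le
      calc (v.1.residueCard : ℝ) ^ ((j v : ℝ) * (1 / N)) ≤ (v.1.residueCard : ℝ) ^ (1 : ℝ) := by
            refine Real.rpow_le_rpow_of_exponent_le hq1 ?_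
            rw [mul_one_div, div_le_one hN0]
            exact_mod_cast hjN v
        _ = v.1.residueCard := Real.rpow_one _
    have hden0 : 0 < (j v : ℝ) * (v.1.residueCard : ℝ) ^ ((j v : ℝ) * (1 / N)) := by
      have : (0 : ℝ) < j v := by exact_mod_cast hj1 v
      positivity
    calc c * ((v.1.residueCard : ℝ))⁻¹ = (1 / 2 ^ (N + 1)) ^ 2 / (N * v.1.residueCard) := by
          rw [hc]
          field_simp
      _ ≤ ‖((γ v.1).map (· ^ j v)).sum‖ ^ 2 /
            ((j v : ℝ) * (v.1.residueCard : ℝ) ^ ((j v : ℝ) * (1 / N))) :=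
          div_le_div₀ (by positivity) (pow_le_pow_left₀ (by positivity) (hjb v) 2) hden0 hden
  have h2 : Summable fun v : {v : HeightOneSpectrum (𝓞 K) // v ∉ S} =>
      c * ((v.1.residueCard : ℝ))⁻¹ :=
    Summable.of_nonneg_of_le (fun v => by positivity) hle h1
  have h3 : Summable fun v : {v : HeightOneSpectrum (𝓞 K) // v ∉ S} => ((v.1.residueCard : ℝ))⁻¹ :=
    (summable_mul_left_iff hc0.ne').mp h2
  have h4 : Summable fun v : HeightOneSpectrum (𝓞 K) => ((v.residueCard : ℝ))⁻¹ :=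
    (hS.summable_compl_iff (f := fun v : HeightOneSpectrum (𝓞 K) => ((v.residueCard : ℝ))⁻¹)).mp h3
  exact Literature.NumberTheory.GaloisRepresentations.not_summable_residueCard_inv h4

end Divergence

/-! ### Local algebra: `det(1 - (A ⊕ B') ⊗ (A' ⊕ B) T)` and complex conjugation -/

section LocalAlgebra

/-- `(α + α') ⊗ β = α ⊗ β + α' ⊗ β` on eigenvalue multisets. [folklore] -/
theorem satakeTensor_add_left (α α' β : Multiset ℂ) :
    satakeTensor (α + α') β = satakeTensor α β + satakeTensor α' β := by
  simp only [satakeTensor, Multiset.add_product, Multiset.map_add]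

/-- `α ⊗ (β + β') = α ⊗ β + α ⊗ β'` on eigenvalue multisets. [folklore] -/
theorem satakeTensor_add_right (α β β' : Multiset ℂ) :
    satakeTensor α (β + β') = satakeTensor α β + satakeTensor α β' := by
  simp only [satakeTensor, Multiset.product_add, Multiset.map_add]

/-- `∏_{c ∈ s + t} (1 - c X) = ∏_{c ∈ s} (1 - c X) · ∏_{c ∈ t} (1 - c X)` (a private copy of
`eulerPolynomial_add` of `AsaiSign`, to keep the imports of this file small). [folklore] -/
private theorem eulerPolynomial_add' (s t : Multiset ℂ) :
    eulerPolynomial (s + t) = eulerPolynomial s * eulerPolynomial t := by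
  simp only [eulerPolynomial, Multiset.map_add, Multiset.prod_add]

/-- **Multiplicativity of the local factors of a direct sum**:
`det(1 - (A ⊕ B') ⊗ (A' ⊕ B) T) = det(1 - A ⊗ A' T) det(1 - A ⊗ B T) det(1 - B' ⊗ A' T) det(1 - B' ⊗ B T)`
(Gelbart (2007), §2: "that is why the multiplicativity of the `L`-functions here still holds").
[folklore] -/
theorem satakePairPolynomial_add_add (α β' α' β : Multiset ℂ) :
    satakePairPolynomial (α + β') (α' + β) =
      satakePairPolynomial α α' * satakePairPolynomial α β *
        (satakePairPolynomial β' α' * satakePairPolynomial β' β) := by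
  simp only [satakePairPolynomial_eq_eulerPolynomial, satakeTensor_add_left, satakeTensor_add_right,
    eulerPolynomial_add']
  ring

/-- `conj (∏_{c ∈ γ} (1 - c x)) = ∏_{c ∈ γ} (1 - c̄ x̄)`. [folklore] -/
theorem conj_eval_eulerPolynomial (γ : Multiset ℂ) (x : ℂ) :
    conj ((eulerPolynomial γ).eval x) = (eulerPolynomial (γ.map conj)).eval (conj x) := by
  induction γ using Multiset.induction_on with
  | empty => simp
  | cons a γ ih =>
    simp [eulerPolynomial_cons, Polynomial.eval_mul, ih, map_mul, map_sub]

/-- `Ā ⊗ B̄ = conj (A ⊗ B)` on eigenvalue multisets. [folklore] -/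
theorem satakeTensor_map_conj (α β : Multiset ℂ) :
    satakeTensor (α.map conj) (β.map conj) = (satakeTensor α β).map conj := by
  induction α using Multiset.induction_on with
  | empty => simp
  | cons a α ih =>
    simp [ih, Multiset.map_map, map_mul]

/-- `conj det(1 - A ⊗ B x) = det(1 - Ā ⊗ B̄ x̄)`. [folklore] -/
theorem conj_eval_satakePairPolynomial (α β : Multiset ℂ) (x : ℂ) :
    conj ((satakePairPolynomial α β).eval x) =
      (satakePairPolynomial (α.map conj) (β.map conj)).eval (conj x) := by
  rw [satakePairPolynomial_eq_eulerPolynomial, satakePairPolynomial_eq_eulerPolynomial,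
    satakeTensor_map_conj, conj_eval_eulerPolynomial]

/-- `conj (q^{-s}) = q^{-s̄}` for a natural number `q`. [folklore] -/
theorem conj_natCast_cpow_neg (q : ℕ) (s : ℂ) :
    conj ((q : ℂ) ^ (-s)) = (q : ℂ) ^ (-(conj s)) := by
  have h := Complex.conj_cpow (q : ℂ) (-(conj s)) (by
    rw [Complex.natCast_arg]
    exact Real.pi_pos.ne)
  rw [map_neg, Complex.conj_conj, map_natCast] at h
  exact h.symm

end LocalAlgebra

/-! ### Global: conjugation symmetry and the factorisation of `L^S(s, (α ⊞ β̄) ⊗ (ᾱ ⊞ β))` -/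

section Global

variable {K : Type} [Field K] [NumberField K]

/-- **Conjugation symmetry of the partial Euler product**:
`conj L^S(s, α ⊗ β) = L^S(s̄, ᾱ ⊗ β̄)` — unconditionally (complex conjugation is a closed
embedding, so it commutes with `tprod` whether or not the product converges). [folklore] -/
theorem conj_partialPairL (S : Set (HeightOneSpectrum (𝓞 K))) (α β : SatakeFamily K) (s : ℂ) :
    conj (partialPairL S α β s) = partialPairL S (conjFamily α) (conjFamily β) (conj s) := by
  unfold partialPairL
  rw [Topology.IsClosedEmbedding.map_tprod _ Complex.isometry_conj.isClosedEmbedding]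
  refine tprod_congr fun v => ?_
  rw [map_inv₀, conj_eval_satakePairPolynomial, conjFamily_apply, conjFamily_apply,
    conj_natCast_cpow_neg]

omit [NumberField K] in
/-- `conj (α ⊞ β̄) = ᾱ ⊞ β`: the conjugate family of `π ⊞ σ̄` is that of `π̄ ⊞ σ`. [folklore] -/
theorem conjFamily_add_map_conj (α β : SatakeFamily K) :
    conjFamily (fun v => α v + (β v).map conj) = fun v => conjFamily α v + β v := by
  funext v
  simp only [conjFamily_apply, Multiset.map_add, Multiset.map_map, Function.comp_def,
    Complex.conj_conj, Multiset.map_id']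

open AdelicGroupData

variable {n m : ℕ} {μ : Measure (gl n K).automorphicQuotient} [(gl n K).IsAutomorphicMeasure μ]
  {μ' : Measure (gl m K).automorphicQuotient} [(gl m K).IsAutomorphicMeasure μ']

/-- **Multiplicativity**: for Satake families `α` of `π` and `β` of `σ` (cuspidal, so that the four
Euler products converge on `Re s > 1` by Jacquet–Shalika's (2.1),
`JacquetShalika1981_multipliable_partialPairL_holds`, applied also to the conjugates `π̄ = P.conj`,
`σ̄ = P'.conj` with families `ᾱ`, `β̄`, `IsSatakeFamilyOf.conj`) and `Re s > 1`,
`L^S(s, (α ⊞ β̄) ⊗ (ᾱ ⊞ β)) = L^S(s, α ⊗ ᾱ) L^S(s, α ⊗ β) · (L^S(s, β̄ ⊗ ᾱ) L^S(s, β̄ ⊗ β))`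
(Gelbart (2007), §2). [folklore] -/
theorem partialPairL_boxplus_eq (P : CuspidalAutomorphicRepGL n K μ)
    (P' : CuspidalAutomorphicRepGL m K μ') {S : Set (HeightOneSpectrum (𝓞 K))}
    {α β : SatakeFamily K} (hα : IsSatakeFamilyOf P S α) (hβ : IsSatakeFamilyOf P' S β)
    {s : ℂ} (hs : 1 < s.re) :
    partialPairL S (fun v => α v + (β v).map conj) (conjFamily fun v => α v + (β v).map conj) s =
      partialPairL S α (conjFamily α) s * partialPairL S α β s *
        (partialPairL S (conjFamily β) (conjFamily α) s * partialPairL S (conjFamily β) β s) := by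
  have m1 : Multipliable fun v : {v : HeightOneSpectrum (𝓞 K) // v ∉ S} =>
      ((satakePairPolynomial (α v.1) ((α v.1).map conj)).eval ((v.1.residueCard : ℂ) ^ (-s)))⁻¹ :=
    JacquetShalika1981_multipliable_partialPairL_holds P P.conj hα hα.conj hs
  have m2 : Multipliable fun v : {v : HeightOneSpectrum (𝓞 K) // v ∉ S} =>
      ((satakePairPolynomial (α v.1) (β v.1)).eval ((v.1.residueCard : ℂ) ^ (-s)))⁻¹ :=
    JacquetShalika1981_multipliable_partialPairL_holds P P' hα hβ hs
  have m3 : Multipliable fun v : {v : HeightOneSpectrum (𝓞 K) // v ∉ S} =>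
      ((satakePairPolynomial ((β v.1).map conj) ((α v.1).map conj)).eval
        ((v.1.residueCard : ℂ) ^ (-s)))⁻¹ :=
    JacquetShalika1981_multipliable_partialPairL_holds P'.conj P.conj hβ.conj hα.conj hs
  have m4 : Multipliable fun v : {v : HeightOneSpectrum (𝓞 K) // v ∉ S} =>
      ((satakePairPolynomial ((β v.1).map conj) (β v.1)).eval ((v.1.residueCard : ℂ) ^ (-s)))⁻¹ :=
    JacquetShalika1981_multipliable_partialPairL_holds P'.conj P' hβ.conj hβ hs
  rw [conjFamily_add_map_conj]
  simp only [partialPairL, conjFamily_apply]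
  calc ∏' v : {v : HeightOneSpectrum (𝓞 K) // v ∉ S},
        ((satakePairPolynomial (α v.1 + (β v.1).map conj) ((α v.1).map conj + β v.1)).eval
          ((v.1.residueCard : ℂ) ^ (-s)))⁻¹
      = ∏' v : {v : HeightOneSpectrum (𝓞 K) // v ∉ S},
          (((satakePairPolynomial (α v.1) ((α v.1).map conj)).eval ((v.1.residueCard : ℂ) ^ (-s)))⁻¹ *
            ((satakePairPolynomial (α v.1) (β v.1)).eval ((v.1.residueCard : ℂ) ^ (-s)))⁻¹ *
          (((satakePairPolynomial ((β v.1).map conj) ((α v.1).map conj)).eval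
              ((v.1.residueCard : ℂ) ^ (-s)))⁻¹ *
            ((satakePairPolynomial ((β v.1).map conj) (β v.1)).eval
              ((v.1.residueCard : ℂ) ^ (-s)))⁻¹)) := by
        refine tprod_congr fun v => ?_
        rw [satakePairPolynomial_add_add, Polynomial.eval_mul, Polynomial.eval_mul,
          Polynomial.eval_mul, mul_inv, mul_inv, mul_inv]
    _ = _ := by
        rw [(m1.mul m2).tprod_mul (m3.mul m4), m1.tprod_mul m2, m3.tprod_mul m4]

/-! ### The analytic core: the continuation of `L^S(s, π ⊗ σ)` does not vanish at `s = 1` -/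

/-- **The analytic core (de la Vallée Poussin–Landau).** Let `α`, `β` be Satake families of
cuspidal `π` on `GL_n`, `σ` on `GL_m` (`n, m ≥ 1`) off a finite `S`. Suppose `L^S(s, π ⊗ σ)` has an
entire continuation `E`, and `s (s - 1) L^S(s, π ⊗ π̄)`, `s (s - 1) L^S(s, σ̄ ⊗ σ)` have entire
continuations `G`, `G'`. Then **`E(1) ≠ 0`**. Proof: module docstring — if `E(1) = 0` then
`D = G G' (E/(s-1)) (E'/(s-1)) / s²`, `E'(s) = conj E(s̄)`, is holomorphic on `Re s > 0` and equals
`L^S(s, γ ⊗ γ̄) = exp(∑ a_m m^{-s})` (`γ = α ⊞ β̄`, `a_m ≥ 0`) on `Re s > 2`, so by Landau's lemma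
the series of `γ` converges at `σ = 1/(n+m)`, contradicting
`not_summable_jsCoeff_mul_rpow_neg_of_norm_prod_eq_one` (`|∏ γ_v| = |ω_π(ϖ_v) conj ω_σ(ϖ_v)| = 1`
by the unitarity of the central characters). [cite: Gelbart2007Nonvanishing, §2]
[cite: MontgomeryVaughan2007, §1.2 Thm. 1.7] -/
theorem partialPairL_continuation_apply_one_ne_zero (hn : 0 < n) (hm : 0 < m)
    (P : CuspidalAutomorphicRepGL n K μ) (P' : CuspidalAutomorphicRepGL m K μ')
    {S : Set (HeightOneSpectrum (𝓞 K))} (hS : S.Finite) {α β : SatakeFamily K}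
    (hα : IsSatakeFamilyOf P S α) (hβ : IsSatakeFamilyOf P' S β)
    {E : ℂ → ℂ} (hE : Differentiable ℂ E) (hEeq : ∀ s : ℂ, 1 < s.re → E s = partialPairL S α β s)
    {G : ℂ → ℂ} (hG : Differentiable ℂ G)
    (hGeq : ∀ s : ℂ, 1 < s.re → G s = s * (s - 1) * partialPairL S α (conjFamily α) s)
    {G' : ℂ → ℂ} (hG' : Differentiable ℂ G')
    (hG'eq : ∀ s : ℂ, 1 < s.re → G' s = s * (s - 1) * partialPairL S (conjFamily β) β s) :
    E 1 ≠ 0 := by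
  intro hE1
  -- the auxiliary family `γ = α ⊞ β̄` of "`π ⊞ σ̄`"
  set γ : SatakeFamily K := fun v => α v + (β v).map conj with hγ
  set N : ℕ := n + m with hN
  have hN1 : 1 ≤ N := by omega
  have hbγ : ∀ v ∉ S, ∀ a ∈ γ v, ‖a‖ ≤ Real.sqrt v.residueCard := by
    intro v hv a ha
    simp only [hγ, Multiset.mem_add, Multiset.mem_map] at ha
    rcases ha with ha | ⟨b, hb, rfl⟩
    · exact norm_satakeParameter_le_sqrt_holds P hα hv ha
    · rw [Complex.norm_conj]
      exact norm_satakeParameter_le_sqrt_holds P' hβ hv hb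
  have hcardγ : ∀ v ∉ S, Multiset.card (γ v) = N := by
    intro v hv
    simp only [hγ, Multiset.card_add, Multiset.card_map, hα.card_eq hv, hβ.card_eq hv, hN]
  have hcardγ' : ∀ v ∉ S, Multiset.card (γ v) ≤ N := fun v hv => (hcardγ v hv).le
  have hprodγ : ∀ v ∉ S, ‖(γ v).prod‖ = 1 := by
    intro v hv
    obtain ⟨ω, hu, -, -, -, hfam⟩ := P.exists_centralCharacter
    obtain ⟨ω', hu', -, -, -, hfam'⟩ := P'.exists_centralCharacter
    have h1 : ‖(α v).prod‖ = 1 := by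
      rw [← (hfam hα v hv).2]
      exact Literature.NumberTheory.GaloisRepresentations.HeckeCharacter.norm_valueAtUniformizer_of_isUnitary hu v
    have h2 : ‖(β v).prod‖ = 1 := by
      rw [← (hfam' hβ v hv).2]
      exact Literature.NumberTheory.GaloisRepresentations.HeckeCharacter.norm_valueAtUniformizer_of_isUnitary hu' v
    simp only [hγ, Multiset.prod_add, norm_mul, h1, one_mul]
    rw [← map_multiset_prod, Complex.norm_conj, h2]
  -- the conjugate continuation `E'(s) = conj E(conj s)` of `L^S(s, σ̄ ⊗ π̄)`
  set E' : ℂ → ℂ := fun s => conj (E (conj s)) with hE'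
  have hE'd : Differentiable ℂ E' := by
    intro x
    have h := (hE (conj x)).conj_conj
    rw [Complex.conj_conj] at h
    exact h
  have hE'eq : ∀ s : ℂ, 1 < s.re → E' s = partialPairL S (conjFamily β) (conjFamily α) s := by
    intro s hs
    have hs' : 1 < (conj s).re := by rwa [Complex.conj_re]
    simp only [hE']
    rw [hEeq _ hs', conj_partialPairL, Complex.conj_conj, partialPairL_comm]
  have hE'1 : E' 1 = 0 := by
    simp only [hE', map_one, hE1, map_zero]
  -- the auxiliary function `D`
  set U : Set ℂ := {s : ℂ | (0 : ℝ) < s.re} with hU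
  have hUo : IsOpen U := isOpen_lt continuous_const Complex.continuous_re
  have h1U : U ∈ 𝓝 (1 : ℂ) := hUo.mem_nhds (by simp [hU])
  set D : ℂ → ℂ := fun s => G s * G' s * dslope E 1 s * dslope E' 1 s / s ^ 2 with hD
  have hDd : DifferentiableOn ℂ D U := by
    have hdE : DifferentiableOn ℂ (dslope E 1) U := (differentiableOn_dslope h1U).mpr hE.differentiableOn
    have hdE' : DifferentiableOn ℂ (dslope E' 1) U :=
      (differentiableOn_dslope h1U).mpr hE'd.differentiableOn
    refine (((hG.differentiableOn.mul hG'.differentiableOn).mul hdE).mul hdE').div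
      (differentiableOn_id.pow 2) fun s hs => ?_
    refine pow_ne_zero 2 fun h => ?_
    simp only [hU, Set.mem_setOf_eq, h, Complex.zero_re] at hs
    exact lt_irrefl _ hs
  have hDeq : ∀ s : ℂ, 1 < s.re → D s = partialPairL S γ (conjFamily γ) s := by
    intro s hs
    have hs0 : s ≠ 0 := by
      rintro rfl
      simp only [Complex.zero_re] at hs
      linarith
    have hs1 : s - 1 ≠ 0 := by
      intro h
      rw [sub_eq_zero] at h
      rw [h, Complex.one_re] at hs
      exact lt_irrefl _ hs
    have hdE : dslope E 1 s = E s / (s - 1) := by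
      have h := sub_smul_dslope E 1 s
      rw [hE1, sub_zero, smul_eq_mul] at h
      rw [eq_div_iff hs1, mul_comm]
      exact h
    have hdE' : dslope E' 1 s = E' s / (s - 1) := by
      have h := sub_smul_dslope E' 1 s
      rw [hE'1, sub_zero, smul_eq_mul] at h
      rw [eq_div_iff hs1, mul_comm]
      exact h
    simp only [hD]
    rw [hdE, hdE', hGeq s hs, hG'eq s hs, hEeq s hs, hE'eq s hs,
      partialPairL_boxplus_eq P P' hα hβ hs]
    field_simp
  -- Landau's lemma: the abscissa of `∑ a_m m^{-s}` is `≤ 0`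
  have hax2 := abscissaOfAbsConv_normSqTraceSeries_le_two hbγ hcardγ'
  have hax0 : LSeries.abscissaOfAbsConv (normSqTraceSeries S γ) ≤ (0 : ℝ) :=
    Literature.NumberTheory.LFunctions.Landau.abscissaOfAbsConv_le_of_exp_eq
      (normSqTraceSeries_nonneg S γ) hax2 hDd fun s hs => by
        rw [hDeq s (by linarith), partialPairL_conjFamily_eq_exp_LSeries hbγ hcardγ' hs]
  -- hence the series of `γ` converges at `σ = 1/N`…
  have hN0 : (0 : ℝ) < 1 / N := by
    have : (0 : ℝ) < N := by exact_mod_cast hN1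
    positivity
  have hσ : LSeriesSummable (normSqTraceSeries S γ) ((1 / N : ℝ) : ℂ) := by
    refine LSeriesSummable_of_abscissaOfAbsConv_lt_re (hax0.trans_lt ?_)
    rw [Complex.ofReal_re]
    exact_mod_cast hN0
  have hsum := (summable_jsCoeff_mul_rpow_neg_iff S γ (1 / N : ℝ)).mpr hσ
  -- … which it does not
  exact not_summable_jsCoeff_mul_rpow_neg_of_norm_prod_eq_one hS hN1 hcardγ hprodγ hsum

/-! ### Arthur–Clozel (2.2) at `s = 1` from the Mœglin–Waldspurger continuation -/

/-- **Jacquet–Shalika / Arthur–Clozel (2.2) at `s₀ = 1`, `n ≠ m`, from Mœglin–Waldspurger.**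
The named fact `JacquetShalika1981_partialPairL_at_one_of_rank_ne` (`L^S(s, π ⊗ σ) → c ≠ 0` as
`s → 1`, `Re s > 1`, for cuspidal `π` on `GL_n`, `σ` on `GL_m`, `n ≠ m`) follows from the
continuation facts `MoeglinWaldspurger1989_partialPairL_entire_of_rank_ne` (Corollaire (i)(a), at
the ranks `(n, m)`) and `MoeglinWaldspurger1989_partialPairL_of_eq_conj` (Corollaire (ii), at rank
`n` and at rank `m`): the limit is `E(1)` for the entire continuation `E`, non-zero by
`partialPairL_continuation_apply_one_ne_zero` — de la Vallée Poussin's positivity argument with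
Landau's lemma in place of Shahidi's Eisenstein-series non-vanishing theorem quoted by
Arthur–Clozel. [cite: ArthurClozelAMS120, Ch. 3 §2 (2.2)]
[cite: MoeglinWaldspurger1989, Appendice, Corollaire (i)(a), (ii), p. 667]
[cite: Gelbart2007Nonvanishing, §2] -/
theorem JacquetShalika1981_partialPairL_at_one_of_rank_ne_of_moeglinWaldspurger
    (h₁ : MoeglinWaldspurger1989_partialPairL_entire_of_rank_ne (n := n) (m := m) (K := K) (μ := μ)
      (μ' := μ'))
    (h₂ : MoeglinWaldspurger1989_partialPairL_of_eq_conj (n := n) (K := K) (μ := μ))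
    (h₂' : MoeglinWaldspurger1989_partialPairL_of_eq_conj (n := m) (K := K) (μ := μ')) :
    JacquetShalika1981_partialPairL_at_one_of_rank_ne (n := n) (m := m) (K := K) (μ := μ)
      (μ' := μ') := by
  intro hnm hn hm P P' S hS α β hα hβ
  obtain ⟨E, hE, hEeq⟩ := h₁ hnm hn hm P P' hS hα hβ
  obtain ⟨G, hG, hGeq⟩ := h₂ hn P P.conj (P.conj_conj).symm hS hα hα.conj
  obtain ⟨G', hG', hG'eq⟩ := h₂' hm P'.conj P' rfl hS hβ.conj hβ
  have h1 : E 1 ≠ 0 :=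
    partialPairL_continuation_apply_one_ne_zero hn hm P P' hS hα hβ hE hEeq hG hGeq hG' hG'eq
  refine ⟨E 1, h1, ?_⟩
  have hc : Tendsto E (𝓝[{s : ℂ | 1 < s.re}] 1) (𝓝 (E 1)) :=
    (hE 1).continuousAt.tendsto.mono_left nhdsWithin_le_nhds
  exact hc.congr' (by filter_upwards [self_mem_nhdsWithin] with s hs using hEeq s hs)

omit [(gl m K).IsAutomorphicMeasure μ'] in
/-- **Jacquet–Shalika / Arthur–Clozel (2.2) at `s₀ = 1`, `n = m`, `π ≇ σ̃`, from
Mœglin–Waldspurger** — the same argument in equal rank: the named fact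
`JacquetShalika1981_partialPairL_at_one_of_ne_conj` follows from
`MoeglinWaldspurger1989_partialPairL_entire_of_ne_conj` (Corollaire (i)(b)) and
`MoeglinWaldspurger1989_partialPairL_of_eq_conj` (Corollaire (ii)).
[cite: ArthurClozelAMS120, Ch. 3 §2 (2.2)]
[cite: MoeglinWaldspurger1989, Appendice, Corollaire (i)(b), (ii), p. 667]
[cite: Gelbart2007Nonvanishing, §2] -/
theorem JacquetShalika1981_partialPairL_at_one_of_ne_conj_of_moeglinWaldspurger
    (h₁ : MoeglinWaldspurger1989_partialPairL_entire_of_ne_conj (n := n) (K := K) (μ := μ))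
    (h₂ : MoeglinWaldspurger1989_partialPairL_of_eq_conj (n := n) (K := K) (μ := μ)) :
    JacquetShalika1981_partialPairL_at_one_of_ne_conj (n := n) (K := K) (μ := μ) := by
  intro hn hm1 P P' hne S hS α β hα hβ
  obtain ⟨E, hE, hEeq⟩ := h₁ hn hm1 P P' hne hS hα hβ
  obtain ⟨G, hG, hGeq⟩ := h₂ hn P P.conj (P.conj_conj).symm hS hα hα.conj
  obtain ⟨G', hG', hG'eq⟩ := h₂ hn P'.conj P' rfl hS hβ.conj hβ
  have h1 : E 1 ≠ 0 :=
    partialPairL_continuation_apply_one_ne_zero hn hn P P' hS hα hβ hE hEeq hG hGeq hG' hG'eq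
  refine ⟨E 1, h1, ?_⟩
  have hc : Tendsto E (𝓝[{s : ℂ | 1 < s.re}] 1) (𝓝 (E 1)) :=
    (hE 1).continuousAt.tendsto.mono_left nhdsWithin_le_nhds
  exact hc.congr' (by filter_upwards [self_mem_nhdsWithin] with s hs using hEeq s hs)

end Global

end Literature.NumberTheory.Automorphic

end
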